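import Literature.NumberTheory.LFunctions.LargeValuesGuthMaynardReduction
import Mathlib.Analysis.Matrix.Spectrum
import Mathlib.Analysis.Matrix.PosDef
import Mathlib.Analysis.MeanInequalitiesPow
import HarnessLib

/-!
# Large values controlled by traces of the Gram matrix (Guth–Maynard §4, Lemmas 4.1 and 4.2)

Topic `NumberTheory/LFunctions`, family RH. The files `ZeroDensityGuthMaynardWindow.lean` and
`LargeValuesGuthMaynardReduction.lean` reduce the tree's named fact
`Literature.NumberTheory.LFunctions.zeroDensity_guth_maynard` (Guth–Maynard, Theorem 1.2) to
Proposition 3.1 of L. Guth, J. Maynard, *New large value estimates for Dirichlet polynomials*,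
Ann. of Math. 203 (2026). This file PROVES the entry point of the proof of that proposition, §4 of
the paper ("The matrix `M_W` and its singular values"): the number of large values of a smoothed
Dirichlet polynomial `D_N(t) = ∑_n w(n/N) b_n n^{it}` on a finite set `W` is controlled by the
traces `tr(G)` and `tr(G³)` of the Gram matrix `G = M_W M_W^*`,
`G_{t₁,t₂} = ∑_n w(n/N)² n^{i(t₁−t₂)}`:

* `GuthMaynardMatrix.card_mul_sq_le_traceBound` —
  `|W| V² ≤ (N+1) (2(tr(G³) − tr(G)³/|W|²)^{1/6} + 2(tr(G)/|W|)^{1/2})²` whenever `|D_N(t)| ≥ V` on `W`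
  and `|b_n| ≤ 1` (Lemma 4.1, `|W|N^{2σ} ≤ s₁(M_W)²‖b‖²`, combined with Lemma 4.2,
  `s₁(A) ≤ 2(tr((AA^*)³) − tr(AA^*)³/m²)^{1/6} + 2(tr(AA^*)/m)^{1/2}`).

("Thus we wish to estimate `tr(M_W M_W^*)` and `tr((M_W M_W^*)³)`" — §§5–11 of the paper, not in the
tree.) No definition and no named fact is introduced; everything in this file is proved, for
arbitrary real weights `ω_n` in place of `w(n/N)`.

## Contents

* §1 `GuthMaynardMatrix.pow_three_sum_le`, `GuthMaynardMatrix.real_ineq` — the power mean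
  inequality `(∑ a_i)³ ≤ k² ∑ a_i³` and the real inequality of Lemma 4.2,
  `x_{i₀} ≤ 2(∑x_i⁶ − (∑x_i²)³/k²)^{1/6} + 2(∑x_i²/k)^{1/2}` (the paper's proof: power mean on the
  other `x_i`, `(S − x²)³ ≥ S³ − 3S²x²`, and the dichotomy `x⁶ ≤ 4E` or `x² ≤ 2S/k`).
* §2 Hermitian matrices over `ℂ` (Mathlib's spectral theorem `Matrix.IsHermitian.spectral_theorem`):
  `trace_pow_eq` (`tr(G^k) = ∑ λ_i^k`), `re_quadForm_le` (`re(c⋆Gc) ≤ λ_max |c|²`),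
  `eigenvalues_nonneg_of_quadForm`, and `eigenvalues_le_traceBound` (Lemma 4.2 for the eigenvalues
  of a positive semi-definite Hermitian matrix, `x_i = λ_i^{1/2}`).
* §3 The Gram matrix: `quadForm_gram_eq` (`c⋆Gc = ∑_n ω_n² |∑_t c_t n^{-it}|²`, so `G` is positive
  semi-definite; the identity `(M_WM_W^*)_{t₁,t₂} = ∑_n w(n/N)²n^{i(t₁−t₂)}` of §4), `gram_isHermitian`,
  `sum_norm_sq_le_of_quadForm_le` (Lemma 4.1 by duality and Cauchy–Schwarz:
  `∑_t |D(t)|² ≤ λ_max(G) ∑_n |b_n|²`), and `card_mul_sq_le_traceBound`.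

## References

* L. Guth, J. Maynard, *New large value estimates for Dirichlet polynomials*, Ann. of Math. (2)
  203 (2026), no. 2; arXiv:2405.20552 (2024): §4, Lemma 4.1, Lemma 4.2 (and its proof,
  the displayed inequality `x₁ ≤ 2(∑x_i⁶ − (∑x_i²)³/k²)^{1/6} + 2(∑x_i²/k)^{1/2}` in its proof).
* H. L. Montgomery, *Topics in Multiplicative Number Theory*, LNM 227, Springer 1971, Ch. 7
  (duality for large values; the cite `[M3]` of the paper).
-/

noncomputable section

open Real Finset Matrix Complex

namespace Literature.NumberTheory.LFunctions

namespace GuthMaynardMatrix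

/-! ## §1. The real inequality behind Lemma 4.2 -/

/-- **Power mean**: for nonnegative reals, `(∑_{i∈s} a_i)³ ≤ (#s)² ∑_{i∈s} a_i³`. [folklore] -/
theorem pow_three_sum_le {ι : Type*} (s : Finset ι) (a : ι → ℝ) (ha : ∀ i ∈ s, 0 ≤ a i) :
    (∑ i ∈ s, a i) ^ 3 ≤ (s.card : ℝ) ^ 2 * ∑ i ∈ s, a i ^ 3 := by
  rcases s.eq_empty_or_nonempty with hs | hs
  · simp [hs]
  have hm : (0 : ℝ) < s.card := by exact_mod_cast hs.card_pos
  have h := Real.pow_arith_mean_le_arith_mean_pow s (fun _ ↦ (s.card : ℝ)⁻¹) a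
    (fun _ _ ↦ by positivity) (by rw [Finset.sum_const, nsmul_eq_mul]; field_simp) ha 3
  rw [← Finset.mul_sum, ← Finset.mul_sum, mul_pow] at h
  have e : ((s.card : ℝ)⁻¹) ^ 3 * (∑ i ∈ s, a i) ^ 3 * (s.card : ℝ) ^ 3 = (∑ i ∈ s, a i) ^ 3 := by
    field_simp
  have e2 : (s.card : ℝ)⁻¹ * (∑ i ∈ s, a i ^ 3) * (s.card : ℝ) ^ 3 = (s.card : ℝ) ^ 2 * ∑ i ∈ s, a i ^ 3 := by
    field_simp
  have := mul_le_mul_of_nonneg_right h (by positivity : (0 : ℝ) ≤ (s.card : ℝ) ^ 3)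
  rwa [e, e2] at this

/-- **The real inequality in the proof of Guth–Maynard's Lemma 4.2**: for nonnegative reals
`x_i` (`i ∈ s`, `#s = k`) and any `i₀ ∈ s`,
`x_{i₀} ≤ 2(∑ x_i⁶ − (∑ x_i²)³/k²)^{1/6} + 2((∑ x_i²)/k)^{1/2}` ("By Hölder's inequality,
`∑_{i≥2} x_i⁶ ≥ (∑_{i≥2} x_i²)³/k²` … `x₁⁶ ≤ max(4(∑x_i⁶ − (∑x_i²)³/k²), 8(∑x_i²)³/k³)`"). The first
radicand is nonnegative by the power mean inequality. [cite: GuthMaynard2026, Lemma 4.2] -/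
theorem real_ineq {ι : Type*} (s : Finset ι) (x : ι → ℝ) (hx : ∀ i ∈ s, 0 ≤ x i) {i₀ : ι}
    (hi₀ : i₀ ∈ s) :
    0 ≤ ∑ i ∈ s, x i ^ 6 - (∑ i ∈ s, x i ^ 2) ^ 3 / (s.card : ℝ) ^ 2 ∧
    x i₀ ≤ 2 * (∑ i ∈ s, x i ^ 6 - (∑ i ∈ s, x i ^ 2) ^ 3 / (s.card : ℝ) ^ 2) ^ (1 / 6 : ℝ) +
      2 * ((∑ i ∈ s, x i ^ 2) / s.card) ^ (1 / 2 : ℝ) := by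
  classical
  have hm : (0 : ℝ) < s.card := by exact_mod_cast Finset.card_pos.2 ⟨i₀, hi₀⟩
  set m : ℝ := (s.card : ℝ) with hmdef
  set S : ℝ := ∑ i ∈ s, x i ^ 2 with hS
  set P : ℝ := ∑ i ∈ s, x i ^ 6 with hP
  set E : ℝ := P - S ^ 3 / m ^ 2 with hE
  have hx0 : 0 ≤ x i₀ := hx i₀ hi₀
  have hS0 : 0 ≤ S := Finset.sum_nonneg fun i _ ↦ by positivity
  -- power mean on all of `s` and on `s \ {i₀}`
  have hpm : S ^ 3 ≤ m ^ 2 * P := by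
    have h := pow_three_sum_le s (fun i ↦ x i ^ 2) (fun i _ ↦ by positivity)
    simp only [← pow_mul] at h
    exact h
  have hE0 : 0 ≤ E := by
    rw [hE, sub_nonneg, div_le_iff₀ (by positivity)]; linarith
  set S' : ℝ := ∑ i ∈ s.erase i₀, x i ^ 2 with hS'
  set P' : ℝ := ∑ i ∈ s.erase i₀, x i ^ 6 with hP'
  have hSS' : S = S' + x i₀ ^ 2 := by
    rw [hS, hS', ← Finset.sum_erase_add _ _ hi₀]
  have hPP' : P = P' + x i₀ ^ 6 := by
    rw [hP, hP', ← Finset.sum_erase_add _ _ hi₀]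
  have hpm' : S' ^ 3 ≤ m ^ 2 * P' := by
    have h := pow_three_sum_le (s.erase i₀) (fun i ↦ x i ^ 2) (fun i _ ↦ by positivity)
    simp only [← pow_mul] at h
    have hcard : ((s.erase i₀).card : ℝ) ^ 2 ≤ m ^ 2 := by
      have : ((s.erase i₀).card : ℝ) ≤ m := by
        rw [hmdef]; exact_mod_cast Finset.card_erase_le
      exact pow_le_pow_left₀ (by positivity) this 2
    have hP'0 : 0 ≤ ∑ i ∈ s.erase i₀, x i ^ (2 * 3) :=
      Finset.sum_nonneg fun i hi ↦ pow_nonneg (hx i (Finset.mem_of_mem_erase hi)) _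
    calc S' ^ 3 ≤ ((s.erase i₀).card : ℝ) ^ 2 * ∑ i ∈ s.erase i₀, x i ^ (2 * 3) := h
      _ ≤ m ^ 2 * ∑ i ∈ s.erase i₀, x i ^ (2 * 3) := mul_le_mul_of_nonneg_right hcard hP'0
      _ = m ^ 2 * P' := by rw [hP']
  -- `(S − x²)³ ≥ S³ − 3S²x²`
  have hS'0 : 0 ≤ S' := Finset.sum_nonneg fun i _ ↦ by positivity
  have hcube : S ^ 3 - 3 * S ^ 2 * x i₀ ^ 2 ≤ S' ^ 3 := by
    have ha : x i₀ ^ 2 ≤ S := by rw [hSS']; linarith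
    have h0 : 0 ≤ x i₀ ^ 2 := by positivity
    rw [show S' = S - x i₀ ^ 2 by rw [hSS']; ring]
    nlinarith [mul_nonneg (mul_nonneg h0 h0) (show 0 ≤ 3 * S - x i₀ ^ 2 by linarith)]
  -- `m² x⁶ ≤ m² E + 3 S² x²`
  have hkey : m ^ 2 * x i₀ ^ 6 ≤ m ^ 2 * E + 3 * S ^ 2 * x i₀ ^ 2 := by
    have e : m ^ 2 * E = m ^ 2 * P - S ^ 3 := by rw [hE]; field_simp
    rw [e, hPP']
    nlinarith
  refine ⟨hE0, ?_⟩
  have hA0 : 0 ≤ 2 * E ^ (1 / 6 : ℝ) := by positivity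
  have hB0 : 0 ≤ 2 * (S / m) ^ (1 / 2 : ℝ) := by positivity
  rcases le_or_gt (S ^ 2 * x i₀ ^ 2) (m ^ 2 * E) with hcase | hcase
  · -- `x⁶ ≤ 4E`
    have h1 : x i₀ ^ 6 ≤ 4 * E := by
      have : m ^ 2 * x i₀ ^ 6 ≤ m ^ 2 * (4 * E) := by nlinarith
      exact le_of_mul_le_mul_left this (by positivity)
    have h2 : x i₀ ≤ (4 * E) ^ (1 / 6 : ℝ) := by
      have e : x i₀ = (x i₀ ^ 6) ^ (1 / 6 : ℝ) := by
        rw [← Real.rpow_natCast, ← Real.rpow_mul hx0]; norm_num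
      rw [e]; exact Real.rpow_le_rpow (by positivity) h1 (by norm_num)
    have h3 : (4 * E) ^ (1 / 6 : ℝ) ≤ 2 * E ^ (1 / 6 : ℝ) := by
      rw [Real.mul_rpow (by norm_num) hE0]
      refine mul_le_mul_of_nonneg_right ?_ (by positivity)
      calc (4 : ℝ) ^ (1 / 6 : ℝ) ≤ (4 : ℝ) ^ (1 / 2 : ℝ) :=
            Real.rpow_le_rpow_of_exponent_le (by norm_num) (by norm_num)
        _ = 2 := by
            rw [show (4 : ℝ) = 2 ^ 2 by norm_num, ← Real.rpow_natCast, ← Real.rpow_mul (by norm_num)]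
            norm_num
    linarith
  · -- `x² < 2S/m`
    rcases hx0.eq_or_lt with hz | hpos
    · rw [← hz]; positivity
    · have h1 : m ^ 2 * x i₀ ^ 6 < 4 * (S ^ 2 * x i₀ ^ 2) := by linarith
      have h2 : m ^ 2 * x i₀ ^ 4 < 4 * S ^ 2 := by
        have hx2 : 0 < x i₀ ^ 2 := by positivity
        have : (m ^ 2 * x i₀ ^ 4) * x i₀ ^ 2 < (4 * S ^ 2) * x i₀ ^ 2 := by nlinarith
        exact lt_of_mul_lt_mul_right this hx2.le
      have h3 : m * x i₀ ^ 2 < 2 * S := by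
        have e1 : m ^ 2 * x i₀ ^ 4 = (m * x i₀ ^ 2) ^ 2 := by ring
        have e2 : 4 * S ^ 2 = (2 * S) ^ 2 := by ring
        rw [e1, e2] at h2
        exact (pow_lt_pow_iff_left₀ (by positivity) (by positivity) two_ne_zero).1 h2
      have h4 : x i₀ ^ 2 ≤ 2 * (S / m) := by
        rw [mul_div_assoc', le_div_iff₀ hm]; linarith
      have h5 : x i₀ ≤ (2 * (S / m)) ^ (1 / 2 : ℝ) := by
        have e : x i₀ = (x i₀ ^ 2) ^ (1 / 2 : ℝ) := by
          rw [← Real.rpow_natCast, ← Real.rpow_mul hx0]; norm_num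
        rw [e]; exact Real.rpow_le_rpow (by positivity) h4 (by norm_num)
      have h6 : (2 * (S / m)) ^ (1 / 2 : ℝ) ≤ 2 * (S / m) ^ (1 / 2 : ℝ) := by
        rw [Real.mul_rpow (by norm_num) (by positivity)]
        refine mul_le_mul_of_nonneg_right ?_ (by positivity)
        calc (2 : ℝ) ^ (1 / 2 : ℝ) ≤ (2 : ℝ) ^ (1 : ℝ) :=
              Real.rpow_le_rpow_of_exponent_le (by norm_num) (by norm_num)
          _ = 2 := Real.rpow_one _
      linarith

/-! ## §2. Hermitian matrices: traces of powers and the quadratic form -/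

variable {m : Type*} [Fintype m] [DecidableEq m]

/-- A Hermitian matrix is `U diag(λ) U⋆` with `U` unitary (Mathlib's spectral theorem, unfolded).
[folklore] -/
theorem eq_unitary_mul_diagonal {G : Matrix m m ℂ} (hG : G.IsHermitian) :
    G = (hG.eigenvectorUnitary : Matrix m m ℂ) * diagonal (fun i ↦ (hG.eigenvalues i : ℂ)) *
      star (hG.eigenvectorUnitary : Matrix m m ℂ) := by
  conv_lhs => rw [hG.spectral_theorem, Unitary.conjStarAlgAut_apply]
  rfl

/-- **Traces of powers of a Hermitian matrix**: `tr(G^k) = ∑_i λ_i^k`. [folklore] -/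
theorem trace_pow_eq {G : Matrix m m ℂ} (hG : G.IsHermitian) (k : ℕ) :
    (G ^ k).trace = ∑ i, (hG.eigenvalues i : ℂ) ^ k := by
  set U : Matrix m m ℂ := (hG.eigenvectorUnitary : Matrix m m ℂ) with hU
  set D : Matrix m m ℂ := diagonal (fun i ↦ (hG.eigenvalues i : ℂ)) with hD
  have hUU : star U * U = 1 := Matrix.mem_unitaryGroup_iff'.1 (SetLike.coe_mem _)
  have hdec : G = U * D * star U := eq_unitary_mul_diagonal hG
  have hpow : ∀ k : ℕ, G ^ k = U * D ^ k * star U := by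
    intro k
    induction k with
    | zero => rw [pow_zero, pow_zero, Matrix.mul_one, Matrix.mem_unitaryGroup_iff.1 (SetLike.coe_mem _)]
    | succ k ih =>
      rw [pow_succ, ih, hdec]
      calc U * D ^ k * star U * (U * D * star U) = U * D ^ k * (star U * U) * D * star U := by
            simp only [Matrix.mul_assoc]
        _ = U * D ^ (k + 1) * star U := by rw [hUU, Matrix.mul_one, pow_succ, Matrix.mul_assoc U]
  rw [hpow k, Matrix.trace_mul_cycle, hUU, Matrix.one_mul, hD, diagonal_pow]
  simp only [trace_diagonal, Pi.pow_apply]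

/-- **The quadratic form of a Hermitian matrix is at most `λ_max |c|²`**: if all eigenvalues are
`≤ Λ` then `re(c⋆ · Gc) ≤ Λ ∑ |c_i|²`. [folklore] -/
theorem re_quadForm_le {G : Matrix m m ℂ} (hG : G.IsHermitian) {Λ : ℝ}
    (hΛ : ∀ i, hG.eigenvalues i ≤ Λ) (c : m → ℂ) :
    (star c ⬝ᵥ (G *ᵥ c)).re ≤ Λ * ∑ i, ‖c i‖ ^ 2 := by
  set U : Matrix m m ℂ := (hG.eigenvectorUnitary : Matrix m m ℂ) with hU
  set D : Matrix m m ℂ := diagonal (fun i ↦ (hG.eigenvalues i : ℂ)) with hD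
  have hUU' : U * star U = 1 := Matrix.mem_unitaryGroup_iff.1 (SetLike.coe_mem _)
  have hdec : G = U * D * star U := eq_unitary_mul_diagonal hG
  set y : m → ℂ := star U *ᵥ c with hy
  -- `c⋆ G c = y⋆ D y`
  have h1 : star c ⬝ᵥ (G *ᵥ c) = star y ⬝ᵥ (D *ᵥ y) := by
    rw [hdec, ← mulVec_mulVec, ← mulVec_mulVec, dotProduct_mulVec, hy, star_mulVec,
      ← star_eq_conjTranspose, star_star]
  -- `y⋆ D y = ∑ λ_i |y_i|²`
  have h2 : star y ⬝ᵥ (D *ᵥ y) = ∑ i, ((hG.eigenvalues i * ‖y i‖ ^ 2 : ℝ) : ℂ) := by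
    rw [hD, dotProduct]
    refine Finset.sum_congr rfl fun i _ ↦ ?_
    rw [mulVec_diagonal, Pi.star_apply]
    have : star (y i) * y i = ((‖y i‖ ^ 2 : ℝ) : ℂ) := by
      rw [Complex.star_def, ← Complex.normSq_eq_conj_mul_self, Complex.normSq_eq_norm_sq]
    calc star (y i) * ((hG.eigenvalues i : ℂ) * y i) = (hG.eigenvalues i : ℂ) * (star (y i) * y i) := by
          ring
      _ = ((hG.eigenvalues i * ‖y i‖ ^ 2 : ℝ) : ℂ) := by rw [this]; push_cast; ring
  -- `∑ |y_i|² = ∑ |c_i|²`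
  have h3 : ∑ i, ‖y i‖ ^ 2 = ∑ i, ‖c i‖ ^ 2 := by
    have hyy : star y ⬝ᵥ y = star c ⬝ᵥ c := by
      rw [hy, star_mulVec, ← star_eq_conjTranspose, star_star, ← dotProduct_mulVec, mulVec_mulVec,
        hUU', one_mulVec]
    have e : ∀ v : m → ℂ, star v ⬝ᵥ v = ((∑ i, ‖v i‖ ^ 2 : ℝ) : ℂ) := by
      intro v
      rw [dotProduct]; push_cast
      refine Finset.sum_congr rfl fun i _ ↦ ?_
      rw [Pi.star_apply, Complex.star_def, ← Complex.normSq_eq_conj_mul_self, Complex.normSq_eq_norm_sq]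
      push_cast; ring
    rw [e, e] at hyy
    exact_mod_cast hyy
  rw [h1, h2, ← h3]
  have : (∑ i, ((hG.eigenvalues i * ‖y i‖ ^ 2 : ℝ) : ℂ)).re = ∑ i, hG.eigenvalues i * ‖y i‖ ^ 2 := by
    rw [← Complex.ofReal_sum, Complex.ofReal_re]
  rw [this, Finset.mul_sum]
  exact Finset.sum_le_sum fun i _ ↦ mul_le_mul_of_nonneg_right (hΛ i) (by positivity)

/-- **Eigenvalues from the quadratic form**: `λ_i = re(v_i⋆ G v_i)` for the unit eigenvector `v_i`;
hence if `re(c⋆ G c) ≥ 0` for all `c`, all eigenvalues are `≥ 0`. [folklore] -/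
theorem eigenvalues_nonneg_of_quadForm {G : Matrix m m ℂ} (hG : G.IsHermitian)
    (h : ∀ c : m → ℂ, 0 ≤ (star c ⬝ᵥ (G *ᵥ c)).re) (i : m) : 0 ≤ hG.eigenvalues i := by
  rw [hG.eigenvalues_eq i]
  exact h _

/-- **Guth–Maynard's Lemma 4.2 for a positive semi-definite Hermitian matrix** ("Bound for
singular values in terms of traces": `s₁(A) ≤ 2(tr((AA*)³) − tr(AA*)³/m²)^{1/6} + 2(tr(AA*)/m)^{1/2}`),
in the form: every eigenvalue `λ` of an `m × m` Hermitian `G` with nonnegative eigenvalues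
satisfies `λ ≤ (2(re tr(G³) − (re tr G)³/m²)^{1/6} + 2(re tr G/m)^{1/2})²` — the real inequality
`real_ineq` applied to `x_i = λ_i^{1/2}`, with `∑ x_i² = tr G`, `∑ x_i⁶ = tr G³`.
[cite: GuthMaynard2026, Lemma 4.2] -/
theorem eigenvalues_le_traceBound {G : Matrix m m ℂ} (hG : G.IsHermitian)
    (hpsd : ∀ i, 0 ≤ hG.eigenvalues i) (i : m) :
    0 ≤ (G ^ 3).trace.re - G.trace.re ^ 3 / (Fintype.card m : ℝ) ^ 2 ∧
    hG.eigenvalues i ≤ (2 * ((G ^ 3).trace.re - G.trace.re ^ 3 / (Fintype.card m : ℝ) ^ 2) ^ (1 / 6 : ℝ) +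
      2 * (G.trace.re / Fintype.card m) ^ (1 / 2 : ℝ)) ^ 2 := by
  set x : m → ℝ := fun j ↦ (hG.eigenvalues j) ^ (1 / 2 : ℝ) with hx
  have hx0 : ∀ j, 0 ≤ x j := fun j ↦ Real.rpow_nonneg (hpsd j) _
  have hx2 : ∀ j, x j ^ 2 = hG.eigenvalues j := fun j ↦ by
    rw [hx]; dsimp only
    rw [← Real.rpow_natCast, ← Real.rpow_mul (hpsd j)]; norm_num
  have hx6 : ∀ j, x j ^ 6 = hG.eigenvalues j ^ 3 := fun j ↦ by
    rw [show (6 : ℕ) = 2 * 3 by norm_num, pow_mul, hx2]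
  have htr : G.trace.re = ∑ j, x j ^ 2 := by
    rw [hG.trace_eq_sum_eigenvalues, Complex.re_sum]
    exact Finset.sum_congr rfl fun j _ ↦ by rw [hx2]; rfl
  have htr3 : (G ^ 3).trace.re = ∑ j, x j ^ 6 := by
    rw [trace_pow_eq hG 3, Complex.re_sum]
    exact Finset.sum_congr rfl fun j _ ↦ by rw [hx6, ← Complex.ofReal_pow, Complex.ofReal_re]
  obtain ⟨hE0, hineq⟩ := real_ineq (Finset.univ : Finset m) x (fun j _ ↦ hx0 j) (Finset.mem_univ i)
  rw [Finset.card_univ] at hE0 hineq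
  rw [htr, htr3]
  refine ⟨hE0, ?_⟩
  have hxi : hG.eigenvalues i = x i ^ 2 := (hx2 i).symm
  rw [hxi]
  have hR0 : 0 ≤ 2 * (∑ j, x j ^ 6 - (∑ j, x j ^ 2) ^ 3 / (Fintype.card m : ℝ) ^ 2) ^ (1 / 6 : ℝ) +
      2 * ((∑ j, x j ^ 2) / Fintype.card m) ^ (1 / 2 : ℝ) := by positivity
  exact pow_le_pow_left₀ (hx0 i) hineq 2

/-! ## §3. The Gram matrix of a smoothed Dirichlet polynomial and duality -/

/-- `n^{it'} · n^{-it} = n^{i(t'−t)}` for `n ≥ 1`. [folklore] -/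
theorem natCast_cpow_mul_I_mul (n : ℕ) (hn : n ≠ 0) (t t' : ℝ) :
    (n : ℂ) ^ ((t' : ℂ) * I) * (n : ℂ) ^ (-((t : ℂ) * I)) = (n : ℂ) ^ ((((t' - t : ℝ)) : ℂ) * I) := by
  rw [← Complex.cpow_add _ _ (by exact_mod_cast hn)]
  congr 1
  push_cast; ring

/-- **The Gram matrix identity** (Guth–Maynard §4: `(M_W M_W^*)_{t₁,t₂} = ∑_n w(n/N)² n^{i(t₁−t₂)}`):
for the matrix `G_{t',t} = ∑_{N≤n≤2N} ω_n² n^{i(t'−t)}` on a finite set of reals `W` (`N ≥ 1`) and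
any `c : W → ℂ`,
`c⋆ · G c = ∑_n |ω_n ∑_{t∈W} c_t n^{-it}|²`; in particular `re(c⋆ · G c) ≥ 0`.
[cite: GuthMaynard2026, Section 4, Lemma 4.1] -/
theorem quadForm_gram_eq {N : ℕ} (hN : 1 ≤ N) (ω : ℕ → ℝ) (W : Finset ℝ) (c : W → ℂ) :
    star c ⬝ᵥ ((Matrix.of fun t' t : W ↦ ∑ n ∈ Finset.Icc N (2 * N),
        (((ω n) ^ 2 : ℝ) : ℂ) * (n : ℂ) ^ ((((t' : ℝ) - (t : ℝ) : ℝ) : ℂ) * I)) *ᵥ c) =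
      ∑ n ∈ Finset.Icc N (2 * N), (((‖((ω n : ℝ) : ℂ) * ∑ t : W, c t * (n : ℂ) ^ (-(((t : ℝ) : ℂ) * I))‖ ^ 2
        : ℝ)) : ℂ) := by
  classical
  -- expand the right-hand side as `A_n conj(A_n)`
  have hR : ∀ n ∈ Finset.Icc N (2 * N),
      (((‖((ω n : ℝ) : ℂ) * ∑ t : W, c t * (n : ℂ) ^ (-(((t : ℝ) : ℂ) * I))‖ ^ 2 : ℝ)) : ℂ) =
        (((ω n) ^ 2 : ℝ) : ℂ) * ∑ t' : W, ∑ t : W,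
          (starRingEnd ℂ) (c t') * c t * (n : ℂ) ^ ((((t' : ℝ) - (t : ℝ) : ℝ) : ℂ) * I) := by
    intro n hn
    have hn0 : n ≠ 0 := by rw [Finset.mem_Icc] at hn; omega
    set A : ℂ := ∑ t : W, c t * (n : ℂ) ^ (-(((t : ℝ) : ℂ) * I)) with hA
    have h1 : (((‖((ω n : ℝ) : ℂ) * A‖ ^ 2 : ℝ)) : ℂ) = (((ω n) ^ 2 : ℝ) : ℂ) * ((starRingEnd ℂ) A * A) := by
      rw [← Complex.normSq_eq_norm_sq, Complex.normSq_eq_conj_mul_self, map_mul, Complex.conj_ofReal]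
      push_cast; ring
    rw [h1]
    congr 1
    rw [hA, map_sum, Finset.sum_mul]
    refine Finset.sum_congr rfl fun t' _ ↦ ?_
    rw [Finset.mul_sum]
    refine Finset.sum_congr rfl fun t _ ↦ ?_
    rw [map_mul, HuxleyLV.conj_natCast_cpow]
    have e : -(starRingEnd ℂ) (((t' : ℝ) : ℂ) * I) = ((t' : ℝ) : ℂ) * I := by
      rw [map_mul, Complex.conj_ofReal, Complex.conj_I]; ring
    rw [e]
    calc (starRingEnd ℂ) (c t') * (n : ℂ) ^ (((t' : ℝ) : ℂ) * I) * (c t * (n : ℂ) ^ (-(((t : ℝ) : ℂ) * I)))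
        = (starRingEnd ℂ) (c t') * c t * ((n : ℂ) ^ (((t' : ℝ) : ℂ) * I) * (n : ℂ) ^ (-(((t : ℝ) : ℂ) * I))) := by
          ring
      _ = (starRingEnd ℂ) (c t') * c t * (n : ℂ) ^ ((((t' : ℝ) - (t : ℝ) : ℝ) : ℂ) * I) := by
          rw [natCast_cpow_mul_I_mul n hn0]
  rw [Finset.sum_congr rfl hR]
  -- expand the left-hand side
  have hL : star c ⬝ᵥ ((Matrix.of fun t' t : W ↦ ∑ n ∈ Finset.Icc N (2 * N),
      (((ω n) ^ 2 : ℝ) : ℂ) * (n : ℂ) ^ ((((t' : ℝ) - (t : ℝ) : ℝ) : ℂ) * I)) *ᵥ c) =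
      ∑ t' : W, ∑ t : W, ∑ n ∈ Finset.Icc N (2 * N), (((ω n) ^ 2 : ℝ) : ℂ) *
        ((starRingEnd ℂ) (c t') * c t * (n : ℂ) ^ ((((t' : ℝ) - (t : ℝ) : ℝ) : ℂ) * I)) := by
    simp only [dotProduct, Matrix.mulVec, Matrix.of_apply, Pi.star_apply, Finset.mul_sum,
      Finset.sum_mul]
    refine Finset.sum_congr rfl fun t' _ ↦ Finset.sum_congr rfl fun t _ ↦
      Finset.sum_congr rfl fun n _ ↦ ?_
    rw [Complex.star_def]; ring
  rw [hL]
  -- both sides are `∑_n ω_n² ∑_{t'} ∑_t conj(c t') c t n^{i(t'−t)}`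
  have hswap : ∑ t' : W, ∑ t : W, ∑ n ∈ Finset.Icc N (2 * N), (((ω n) ^ 2 : ℝ) : ℂ) *
        ((starRingEnd ℂ) (c t') * c t * (n : ℂ) ^ ((((t' : ℝ) - (t : ℝ) : ℝ) : ℂ) * I)) =
      ∑ n ∈ Finset.Icc N (2 * N), ∑ t' : W, ∑ t : W, (((ω n) ^ 2 : ℝ) : ℂ) *
        ((starRingEnd ℂ) (c t') * c t * (n : ℂ) ^ ((((t' : ℝ) - (t : ℝ) : ℝ) : ℂ) * I)) := by
    rw [Finset.sum_congr rfl (fun (t' : W) _ ↦ (Finset.sum_comm :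
      ∑ t : W, ∑ n ∈ Finset.Icc N (2 * N), (((ω n) ^ 2 : ℝ) : ℂ) *
        ((starRingEnd ℂ) (c t') * c t * (n : ℂ) ^ ((((t' : ℝ) - (t : ℝ) : ℝ) : ℂ) * I)) = _)),
      Finset.sum_comm]
  rw [hswap]
  refine Finset.sum_congr rfl fun n _ ↦ ?_
  rw [Finset.mul_sum]
  refine Finset.sum_congr rfl fun t' _ ↦ ?_
  rw [Finset.mul_sum]

/-- The Gram matrix `G_{t',t} = ∑_{N≤n≤2N} ω_n² n^{i(t'−t)}` is Hermitian. [folklore] -/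
theorem gram_isHermitian (N : ℕ) (ω : ℕ → ℝ) (W : Finset ℝ) :
    (Matrix.of fun t' t : W ↦ ∑ n ∈ Finset.Icc N (2 * N),
        (((ω n) ^ 2 : ℝ) : ℂ) * (n : ℂ) ^ ((((t' : ℝ) - (t : ℝ) : ℝ) : ℂ) * I)).IsHermitian := by
  rw [Matrix.IsHermitian]
  ext t t'
  rw [Matrix.conjTranspose_apply, Matrix.of_apply, Matrix.of_apply, star_sum]
  refine Finset.sum_congr rfl fun n _ ↦ ?_
  rw [star_mul', Complex.star_def, Complex.conj_ofReal, GuthMaynardReduction.conj_natCast_cpow_mul_I]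
  congr 2
  push_cast; ring

/-- **Duality (Guth–Maynard Lemma 4.1, "Large values of Dirichlet polynomials controlled by
singular values": `|W| N^{2σ} ≤ ∑_{t∈W} |D_N(t)|² ≤ s₁(M_W)² ‖b‖²`).** In the form: if the
quadratic form of the Gram matrix satisfies `re(c⋆ · G c) ≤ Λ ∑ |c_t|²` for all `c` (`Λ ≥ 0`), then
`∑_{t∈W} |∑_{N≤n≤2N} ω_n b_n n^{it}|² ≤ Λ ∑_{N≤n≤2N} |b_n|²`. (Proof by duality and Cauchy–Schwarz:
`X = ∑_t |D(t)|² = ∑_n b_n conj(A_n)`, `A_n = ω_n ∑_t D(t) n^{-it}`, `∑_n |A_n|² = d⋆ · G d ≤ Λ X`.)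
[cite: GuthMaynard2026, Lemma 4.1] -/
theorem sum_norm_sq_le_of_quadForm_le {N : ℕ} (hN : 1 ≤ N) (ω : ℕ → ℝ) (b : ℕ → ℂ)
    (W : Finset ℝ) {Λ : ℝ} (hΛ0 : 0 ≤ Λ)
    (hΛ : ∀ c : W → ℂ, (star c ⬝ᵥ ((Matrix.of fun t' t : W ↦ ∑ n ∈ Finset.Icc N (2 * N),
        (((ω n) ^ 2 : ℝ) : ℂ) * (n : ℂ) ^ ((((t' : ℝ) - (t : ℝ) : ℝ) : ℂ) * I)) *ᵥ c)).re ≤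
        Λ * ∑ t : W, ‖c t‖ ^ 2) :
    ∑ t ∈ W, ‖∑ n ∈ Finset.Icc N (2 * N), ((ω n : ℝ) : ℂ) * b n * (n : ℂ) ^ (((t : ℂ)) * I)‖ ^ 2 ≤
      Λ * ∑ n ∈ Finset.Icc N (2 * N), ‖b n‖ ^ 2 := by
  classical
  set D : ℝ → ℂ := fun t ↦ ∑ n ∈ Finset.Icc N (2 * N), ((ω n : ℝ) : ℂ) * b n * (n : ℂ) ^ (((t : ℂ)) * I)
    with hD
  set d : W → ℂ := fun t ↦ D (t : ℝ) with hd
  set X : ℝ := ∑ t ∈ W, ‖D t‖ ^ 2 with hX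
  set A : ℕ → ℂ := fun n ↦ ((ω n : ℝ) : ℂ) * ∑ t : W, d t * (n : ℂ) ^ (-(((t : ℝ) : ℂ) * I)) with hA
  have hX0 : 0 ≤ X := Finset.sum_nonneg fun t _ ↦ by positivity
  have hXsub : X = ∑ t : W, ‖d t‖ ^ 2 := by rw [hX, hd, ← Finset.sum_coe_sort]
  -- `X = ∑_n b_n conj(A_n)` (as complex numbers)
  have hXeq : (X : ℂ) = ∑ n ∈ Finset.Icc N (2 * N), b n * (starRingEnd ℂ) (A n) := by
    have h1 : (X : ℂ) = ∑ t : W, (starRingEnd ℂ) (d t) * d t := by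
      rw [hXsub, Complex.ofReal_sum]
      refine Finset.sum_congr rfl fun t _ ↦ ?_
      rw [← Complex.normSq_eq_norm_sq, Complex.normSq_eq_conj_mul_self]
    rw [h1]
    -- expand `d t` in the second factor
    have h2 : ∀ t : W, (starRingEnd ℂ) (d t) * d t =
        ∑ n ∈ Finset.Icc N (2 * N), b n * ((starRingEnd ℂ) (d t) * ((ω n : ℝ) : ℂ) * (n : ℂ) ^ (((((t : ℝ)) : ℂ)) * I)) := by
      intro t
      rw [hd]; dsimp only; rw [hD]; dsimp only
      rw [Finset.mul_sum]
      refine Finset.sum_congr rfl fun n _ ↦ ?_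
      ring
    rw [Finset.sum_congr rfl (fun t _ ↦ h2 t), Finset.sum_comm]
    refine Finset.sum_congr rfl fun n _ ↦ ?_
    rw [hA]; dsimp only
    rw [map_mul, Complex.conj_ofReal, map_sum, Finset.mul_sum, Finset.mul_sum]
    refine Finset.sum_congr rfl fun t _ ↦ ?_
    rw [map_mul, HuxleyLV.conj_natCast_cpow]
    have e : -(starRingEnd ℂ) (((t : ℝ) : ℂ) * I) = ((t : ℝ) : ℂ) * I := by
      rw [map_mul, Complex.conj_ofReal, Complex.conj_I]; ring
    rw [e]; ring
  -- `∑_n |A_n|² = d⋆ G d ≤ Λ X`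
  have hA2 : ∑ n ∈ Finset.Icc N (2 * N), ‖A n‖ ^ 2 ≤ Λ * X := by
    have hq := quadForm_gram_eq hN ω W d
    have hre := hΛ d
    rw [hq] at hre
    rw [← Complex.ofReal_sum, Complex.ofReal_re] at hre
    rw [hXsub]
    exact hre
  -- Cauchy–Schwarz
  have hCS : X ^ 2 ≤ (∑ n ∈ Finset.Icc N (2 * N), ‖b n‖ ^ 2) * (∑ n ∈ Finset.Icc N (2 * N), ‖A n‖ ^ 2) := by
    have h1 : X ≤ ∑ n ∈ Finset.Icc N (2 * N), ‖b n‖ * ‖A n‖ := by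
      have : X = ‖(X : ℂ)‖ := by rw [Complex.norm_real, Real.norm_of_nonneg hX0]
      rw [this, hXeq]
      refine (norm_sum_le _ _).trans (Finset.sum_le_sum fun n _ ↦ ?_)
      rw [norm_mul, Complex.norm_conj]
    calc X ^ 2 ≤ (∑ n ∈ Finset.Icc N (2 * N), ‖b n‖ * ‖A n‖) ^ 2 := pow_le_pow_left₀ hX0 h1 2
      _ ≤ _ := Finset.sum_mul_sq_le_sq_mul_sq _ _ _
  -- conclude
  have hB0 : 0 ≤ ∑ n ∈ Finset.Icc N (2 * N), ‖b n‖ ^ 2 := Finset.sum_nonneg fun n _ ↦ by positivity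
  rcases hX0.eq_or_lt with hX00 | hXpos
  · rw [← hX00]; positivity
  · have h : X ^ 2 ≤ ((∑ n ∈ Finset.Icc N (2 * N), ‖b n‖ ^ 2) * Λ) * X := by
      calc X ^ 2 ≤ _ := hCS
        _ ≤ (∑ n ∈ Finset.Icc N (2 * N), ‖b n‖ ^ 2) * (Λ * X) := mul_le_mul_of_nonneg_left hA2 hB0
        _ = _ := by ring
    rw [sq] at h
    have := le_of_mul_le_mul_right h hXpos
    rw [mul_comm]; exact this

/-- **Large values controlled by the traces of the Gram matrix** (Guth–Maynard §4, Lemmas 4.1 and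
4.2 combined: `|W| N^{2σ} ≤ ‖b‖² s₁(M_W)²` and
`s₁(M_W) ≤ 2(tr((M_WM_W^*)³) − tr(M_WM_W^*)³/|W|²)^{1/6} + 2(tr(M_WM_W^*)/|W|)^{1/2}`, with
`(M_WM_W^*)_{t₁,t₂} = ∑_n w(n/N)² n^{i(t₁−t₂)}`). For real weights `ω_n`, `1`-bounded `b_n`, a
finite set of reals `W` with `|∑_{N≤n≤2N} ω_n b_n n^{it}| ≥ V` on `W` (`N ≥ 1`, `V > 0`), and the Gram
matrix `G_{t',t} = ∑_{N≤n≤2N} ω_n² n^{i(t'−t)}`: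
`|W| V² ≤ (N+1) (2(re tr(G³) − (re tr G)³/|W|²)^{1/6} + 2(re tr G/|W|)^{1/2})²`.
("Thus we wish to estimate `tr(M_W M_W^*)` and `tr((M_W M_W^*)³)`.")
[cite: GuthMaynard2026, Lemmas 4.1 and 4.2] -/
theorem card_mul_sq_le_traceBound {N : ℕ} (hN : 1 ≤ N) (ω : ℕ → ℝ) {b : ℕ → ℂ}
    (hb : ∀ n, ‖b n‖ ≤ 1) (W : Finset ℝ) {V : ℝ} (hV : 0 < V)
    (hlarge : ∀ t ∈ W, V ≤ ‖∑ n ∈ Finset.Icc N (2 * N), ((ω n : ℝ) : ℂ) * b n * (n : ℂ) ^ (((t : ℂ)) * I)‖)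
    (G : Matrix W W ℂ)
    (hG : G = Matrix.of fun t' t : W ↦ ∑ n ∈ Finset.Icc N (2 * N),
        (((ω n) ^ 2 : ℝ) : ℂ) * (n : ℂ) ^ ((((t' : ℝ) - (t : ℝ) : ℝ) : ℂ) * I)) :
    0 ≤ (G ^ 3).trace.re - G.trace.re ^ 3 / (W.card : ℝ) ^ 2 ∧
    (W.card : ℝ) * V ^ 2 ≤ ((N : ℝ) + 1) *
      (2 * ((G ^ 3).trace.re - G.trace.re ^ 3 / (W.card : ℝ) ^ 2) ^ (1 / 6 : ℝ) +
        2 * (G.trace.re / W.card) ^ (1 / 2 : ℝ)) ^ 2 := by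
  classical
  rcases W.eq_empty_or_nonempty with hW | hW
  · subst hW
    simp
  obtain ⟨t₀, ht₀⟩ := hW
  have hherm : G.IsHermitian := by rw [hG]; exact gram_isHermitian N ω W
  -- positivity of the quadratic form
  have hpsd' : ∀ c : W → ℂ, 0 ≤ (star c ⬝ᵥ (G *ᵥ c)).re := by
    intro c
    rw [hG, quadForm_gram_eq hN ω W c, ← Complex.ofReal_sum, Complex.ofReal_re]
    exact Finset.sum_nonneg fun n _ ↦ by positivity
  have hpsd : ∀ i, 0 ≤ hherm.eigenvalues i := eigenvalues_nonneg_of_quadForm hherm hpsd'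
  -- the trace bound on the eigenvalues
  set TB : ℝ := (2 * ((G ^ 3).trace.re - G.trace.re ^ 3 / (W.card : ℝ) ^ 2) ^ (1 / 6 : ℝ) +
      2 * (G.trace.re / W.card) ^ (1 / 2 : ℝ)) ^ 2 with hTB
  have hcardW : (Fintype.card W : ℝ) = W.card := by rw [Fintype.card_coe]
  have hEB := fun i ↦ eigenvalues_le_traceBound hherm hpsd i
  simp only [hcardW] at hEB
  have hE0 : 0 ≤ (G ^ 3).trace.re - G.trace.re ^ 3 / (W.card : ℝ) ^ 2 := (hEB ⟨t₀, ht₀⟩).1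
  have hΛ : ∀ i, hherm.eigenvalues i ≤ TB := fun i ↦ (hEB i).2
  have hTB0 : 0 ≤ TB := by rw [hTB]; positivity
  -- duality
  have hquad : ∀ c : W → ℂ, (star c ⬝ᵥ ((Matrix.of fun t' t : W ↦ ∑ n ∈ Finset.Icc N (2 * N),
      (((ω n) ^ 2 : ℝ) : ℂ) * (n : ℂ) ^ ((((t' : ℝ) - (t : ℝ) : ℝ) : ℂ) * I)) *ᵥ c)).re ≤
      TB * ∑ t : W, ‖c t‖ ^ 2 := by
    intro c
    have := re_quadForm_le hherm hΛ c
    rwa [hG] at this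
  have hdual := sum_norm_sq_le_of_quadForm_le hN ω b W hTB0 hquad
  -- `|W| V² ≤ ∑_t |D(t)|²` and `∑ |b_n|² ≤ N + 1`
  have hlow : (W.card : ℝ) * V ^ 2 ≤
      ∑ t ∈ W, ‖∑ n ∈ Finset.Icc N (2 * N), ((ω n : ℝ) : ℂ) * b n * (n : ℂ) ^ (((t : ℂ)) * I)‖ ^ 2 := by
    calc (W.card : ℝ) * V ^ 2 = ∑ _t ∈ W, V ^ 2 := by simp
      _ ≤ _ := Finset.sum_le_sum fun t ht ↦ pow_le_pow_left₀ hV.le (hlarge t ht) 2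
  have hbsum : ∑ n ∈ Finset.Icc N (2 * N), ‖b n‖ ^ 2 ≤ (N : ℝ) + 1 := by
    calc ∑ n ∈ Finset.Icc N (2 * N), ‖b n‖ ^ 2 ≤ ∑ n ∈ Finset.Icc N (2 * N), (1 : ℝ) :=
          Finset.sum_le_sum fun n _ ↦ pow_le_one₀ (norm_nonneg _) (hb n)
      _ = (N : ℝ) + 1 := by
          rw [Finset.sum_const, Nat.card_Icc, nsmul_eq_mul, mul_one]
          have : 2 * N + 1 - N = N + 1 := by omega
          rw [this]; push_cast; ring
  refine ⟨hE0, ?_⟩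
  calc (W.card : ℝ) * V ^ 2 ≤ _ := hlow
    _ ≤ TB * ∑ n ∈ Finset.Icc N (2 * N), ‖b n‖ ^ 2 := hdual
    _ ≤ TB * ((N : ℝ) + 1) := mul_le_mul_of_nonneg_left hbsum hTB0
    _ = ((N : ℝ) + 1) * TB := mul_comm _ _

end GuthMaynardMatrix

end Literature.NumberTheory.LFunctions

end
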